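import Summits.BirchSwinnertonDyer.BirchSwinnertonDyer.Theorems.ManinLocalTwoThreeCDivisionGamma1Core
import Literature.NumberTheory.EllipticCurves.ModularFormsGamma0FreeModule
import Literature.NumberTheory.EllipticCurves.ModularCurveKleinJ
import HarnessLib

/-!
# The `x`-coordinate of an `X₁(N)`-parametrisation as a quotient of `Γ₁(N)`-forms (toward Stevens 1982 Thm 1.3.1 (b))
(route `ManinLocalTwoThree`, crux C2 `ManinOddAtFour` stmt-BirchSwinnertonDyer-22967; cell bsd-f2-manin, prover seat p1 gen 22;
`--supports stmt-BirchSwinnertonDyer-22967`)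

For an `X₁(N)`-parametrisation datum `D₁` of `W` (Manin constant `c ≠ 0`, `cΛ₁(f) ⊆ Λ_W`) the parametrisation is
`φ₁(τ) = u_W(c·ℰ_f(τ))`, with `x`-coordinate `℘_{Λ_W}(cℰ_f) − b₂/12 = c⁻²℘_{L₁}(ℰ_f) − b₂/12`, `L₁ = c⁻¹Λ_W ⊇ Λ₁(f)`.
This file presents the `Γ₁(N)`-invariant meromorphic function `X = ℘_{L₁}(ℰ_f)` as a quotient of HOLOMORPHIC MODULAR FORMS ON
`Γ₁(N)`: `X · H = A` off the poles, `H = 12·G·Δ^a` with `G ∈ S_k(Γ₀(N))` an INTEGER-coefficient cusp form, `A` a holomorphic form of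
weight `k + 12a` on `Γ₁(N)` vanishing at every cusp.  Ingredients (all tree theorems): the integer `x`-presentation of
`℘_{L″}(ℰ_f)`, `L″ = (cφ(N))⁻¹Λ_W ⊇ Λ₀(f) ∪ L₁` (`CDivision.exists_int_isXPresentation_gamma1`), the datum-free pole-killing /
invariant extension `CDivision.exists_cDivisionWitness_of_presentation` (stabiliser `{γ ∈ Γ₀(N) : {∞,γ∞}_f ∈ L₁} ⊇ Γ₁(N)`), and the
growth estimate at the cusps (port of `CDivGrowth.cDivGrowth_uniform` with the sharper conclusion `→ 0`).

* `exists_exponent_isZeroAtImInfty` — datum-free growth: for a finite-index `Γ ≤ SL₂(ℤ)` there is `a` such that every `Γ`-invariant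
  `F = ℘_L(ℰ_f)·(12·B·Δ^a)` (off the poles; `B ∈ M_w(Γ₀(N))`) satisfies `F ∣ g → 0` at `i∞` for every `g ∈ SL₂(ℤ)`;
* `exists_xPresentation` — the presentation `X·(12GΔ^a) = A` with `A ∈ formSpace Γ₁(N) (k+12a)`, all translates of `A` vanishing at `i∞`.

This is the `x`-half of the analytic input for the Galois action on the cusp values of `φ₁` (Stevens 1982, Thm. 1.3.1 (b); the
`q`-expansion principle for translates, `Literature.NumberTheory.ModularForms.GammaTranslates*`).  No definitions, no sorry.
BSD is not proved by this file; C2 is not proved by this file.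
[cite: Stevens1982, §1.3 Thm. 1.3.1] [cite: ShimuraIATAF1971, §2.4 and Thm. 7.14]
-/

set_option linter.dupNamespace false
set_option autoImplicit false

noncomputable section

open Complex Filter Topology Set Function
open UpperHalfPlane hiding I
open scoped Real Topology Manifold MatrixGroups PeriodPair ModularForm
open ModularForm CongruenceSubgroup
open Literature.NumberTheory.EllipticCurves Literature.NumberTheory.EllipticCurves.ModularForms

namespace Summit.BirchSwinnertonDyer.BirchSwinnertonDyer.Theorems.ManinLocalTwoThree.StevensGalois

variable {N : ℕ} [NeZero N]

/-! ## §1 Growth at the cusps (datum-free, conclusion `→ 0`) -/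

/-- **Datum-free growth lemma.**  For `f ≠ 0`, any lattice `L` and a finite-index `Γ ≤ SL₂(ℤ)` there is `a : ℕ` such that every
`Γ`-invariant `F` of weight `w + 12a` with `F = ℘_L(ℰ_f)·(12·B·Δ^a)` off the poles (`B ∈ M_w(Γ₀(N))`) has ALL its translates
`F ∣ g` tending to `0` at `i∞` (`℘_L(C_r + V_{f∣r})·Δ^a → 0`, `B ∣ r` bounded).  Port of `CDivGrowth.cDivGrowth_uniform`.
[cite: ShimuraIATAF1971, §2.4, Thm. 7.14] -/
theorem exists_exponent_isZeroAtImInfty (f : CuspForm (Gamma0 N) 2) (hf : f ≠ 0) (L : PeriodPair)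
    (Γ : Subgroup SL(2, ℤ)) [Γ.FiniteIndex] :
    ∃ a : ℕ, ∀ (w : ℤ) (B : ModularForm (Gamma0 N) w) (F : ℍ → ℂ), (∀ γ ∈ Γ, F ∣[w + 12 * (a : ℤ)] γ = F) →
      (∀ τ : ℍ, eichlerIntegral f τ ∉ L.lattice →
        F τ = ℘[L] (eichlerIntegral f τ) * ((12 : ℂ) * B τ * ModularForm.discriminant τ ^ a)) →
      ∀ g : SL(2, ℤ), IsZeroAtImInfty (F ∣[w + 12 * (a : ℤ)] g) := by
  classical
  obtain ⟨R, hR⟩ := exists_finset_mul_cover Γ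
  set m : SL(2, ℤ) → ℕ := fun r ↦ analyticOrderNatAt (cuspFunction N (verticalIntegral (⇑f ∣[(2 : ℤ)] r))) 0 with hm
  set a : ℕ := 2 + ∑ r ∈ R, (2 * m r + 1) with ha
  have haR : ∀ r ∈ R, 2 * m r + 1 ≤ a := fun r hr ↦
    (Finset.single_le_sum (f := fun r ↦ 2 * m r + 1) (fun _ _ ↦ Nat.zero_le _) hr).trans (Nat.le_add_left _ _)
  refine ⟨a, fun w B F hFinv hFeq g ↦ ?_⟩
  obtain ⟨γ, hγ, r, hr, hg⟩ := hR g
  have hslash : F ∣[w + 12 * (a : ℤ)] g = F ∣[w + 12 * (a : ℤ)] r := by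
    rw [hg, SlashAction.slash_mul, hFinv γ hγ]
  obtain ⟨C, hC⟩ := exists_eichlerIntegral_smul_eq f r
  obtain ⟨T, hT⟩ := exists_forall_eichlerIntegral_smul_notMem f hf L r
  have hlim := (isCuspFunction_verticalIntegral_slash f r).tendsto_weierstrassP_mul_pow_atImInfty
    (verticalIntegral_slash_ne_zero f hf r) isCuspFunction_discriminant L C (haR r hr)
  have hbdd : IsBoundedUnder (· ≤ ·) atImInfty (fun τ : ℍ ↦ ‖(12 : ℂ) * (⇑B ∣[w] r) τ‖) := by
    obtain ⟨M, A, hM⟩ := UpperHalfPlane.isBoundedAtImInfty_iff.mp (ModularFormClass.bdd_at_infty_slash B r)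
    refine ⟨12 * M, ?_⟩
    rw [Filter.eventually_map]
    filter_upwards [(atImInfty_mem _).mpr ⟨A, fun _ h ↦ h⟩] with τ hτ
    rw [norm_mul, Complex.norm_ofNat]
    exact mul_le_mul_of_nonneg_left (hM τ hτ) (by norm_num)
  have hprod := hlim.zero_mul_isBoundedUnder_le hbdd
  rw [hslash]
  refine (hprod.congr' ?_ : Tendsto (F ∣[w + 12 * (a : ℤ)] r) atImInfty (𝓝 0))
  filter_upwards [(atImInfty_mem _).mpr ⟨T, fun _ h ↦ h⟩] with τ hτ
  have hd : denom (r : SL(2, ℤ)) τ ≠ 0 := denom_ne_zero _ τ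
  -- the value of `F ∣ r` high in the cusp (as in `CDivGrowth.cDivGrowth_uniform`)
  have hval : (F ∣[w + 12 * (a : ℤ)] r) τ =
      ℘[L] (C + verticalIntegral (⇑f ∣[(2 : ℤ)] r) τ) * ModularForm.discriminant τ ^ a *
        ((12 : ℂ) * (⇑B ∣[w] r) τ) := by
    rw [ModularForm.SL_slash_apply, ModularForm.SL_slash_apply, hFeq (r • τ) (hT τ hτ), hC τ, discriminant_apply_smul r τ,
      mul_pow, ← zpow_natCast, ← zpow_mul, neg_add, zpow_add₀ hd, zpow_neg, zpow_neg]
    field_simp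
  exact hval.symm

/-! ## §2 The presentation of `X = ℘_{L₁}(ℰ_f)` by forms on `Γ₁(N)` -/

/-- `c⁻¹ ≠ 0`. [folklore] -/
private theorem inv_c_ne_zero {W : WeierstrassCurve ℚ} (D₁ : Gamma1ParametrizationData W N) (hc : (D₁.c : ℂ) ≠ 0) :
    (D₁.c : ℂ)⁻¹ ≠ 0 := inv_ne_zero hc

/-- `L₁ = c⁻¹Λ_W ⊆ L″ = (cφ(N))⁻¹Λ_W`. [cite: ShimuraIATAF1971, §2.4] -/
theorem lattice_L₁_le_L'' {W : WeierstrassCurve ℚ} (D₁ : Gamma1ParametrizationData W N) (hc : (D₁.c : ℂ) ≠ 0) :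
    ∀ z ∈ (D₁.L.mulLeft ((D₁.c : ℂ)⁻¹) (inv_ne_zero hc)).lattice,
      z ∈ (D₁.L.mulLeft (((D₁.c : ℂ) * (Nat.totient N : ℂ))⁻¹) (CDivision.inv_c_mul_totient_ne_zero D₁ hc)).lattice := by
  intro z hz
  rw [PeriodPair.mem_mulLeft_lattice, inv_inv] at hz ⊢
  have hφ : (Nat.totient N : ℂ) = ((Nat.totient N : ℤ) : ℂ) := by push_cast; rfl
  rw [mul_assoc]
  obtain ⟨m, n, h⟩ := PeriodPair.mem_lattice.mp hz
  refine PeriodPair.mem_lattice.mpr ⟨(Nat.totient N : ℤ) * m, (Nat.totient N : ℤ) * n, ?_⟩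
  rw [mul_left_comm, ← h]
  push_cast
  ring

/-- `Γ₁(N)`-cusp symbols lie in `L₁ = c⁻¹Λ_W` (`cΛ₁(f) ⊆ Λ_W`). [cite: Stevens1989, §2] -/
theorem cuspSymbol_mem_L₁ {W : WeierstrassCurve ℚ} (D₁ : Gamma1ParametrizationData W N) (hc : (D₁.c : ℂ) ≠ 0)
    (γ : Gamma0 N) (hγ : (γ : SL(2, ℤ)) ∈ Gamma1 N) :
    cuspSymbol D₁.f γ ∈ (D₁.L.mulLeft ((D₁.c : ℂ)⁻¹) (inv_ne_zero hc)).lattice := by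
  rw [PeriodPair.mem_mulLeft_lattice, inv_inv]
  have h := cuspSymbol_mem_periodLatticeGamma1 D₁.f ⟨(γ : SL(2, ℤ)), hγ⟩
  exact D₁.smul_periodLatticeGamma1_le _ h

/-- **The `x`-presentation on `Γ₁(N)`.**  For an `X₁(N)`-datum `D₁` (`c ≠ 0`) there are `k ≥ 12`, `a`, an INTEGER-coefficient cusp
form `G ∈ S_k(Γ₀(N))`, `G ≠ 0`, and a holomorphic `A ∈ M_{k+12a}(Γ₁(N))` all of whose `SL₂(ℤ)`-translates vanish at `i∞`, with
`12·℘_{L₁}(ℰ_f(τ))·G(τ)·Δ(τ)^a = A(τ)` whenever `ℰ_f(τ) ∉ L₁ = c⁻¹Λ_W`. [cite: ShimuraIATAF1971, §2.4 and Thm. 7.14] [cite: Stevens1982, §1.3] -/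
theorem exists_xPresentation {W : WeierstrassCurve ℚ} (D₁ : Gamma1ParametrizationData W N) (hc : (D₁.c : ℂ) ≠ 0) :
    ∃ (k : ℤ) (a : ℕ) (G : CuspForm (Gamma0 N) k) (A : ℍ → ℂ), 12 ≤ k ∧ G ≠ 0 ∧ (∀ m, ∃ z : ℤ, cuspCoeff G m = z) ∧
      A ∈ formSpace (Gamma1 N : Subgroup SL(2, ℤ)) (k + 12 * (a : ℤ)) ∧
      (∀ g : SL(2, ℤ), IsZeroAtImInfty (A ∣[k + 12 * (a : ℤ)] g)) ∧
      ∀ τ : ℍ, eichlerIntegral D₁.f τ ∉ (D₁.L.mulLeft ((D₁.c : ℂ)⁻¹) (inv_ne_zero hc)).lattice →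
        12 * ℘[D₁.L.mulLeft ((D₁.c : ℂ)⁻¹) (inv_ne_zero hc)] (eichlerIntegral D₁.f τ) * G τ * ModularForm.discriminant τ ^ a = A τ := by
  have hf : D₁.f ≠ 0 := D₁.isNewformOf.1.ne_zero
  obtain ⟨k, Fx, G, hk, hX, hGint⟩ := CDivision.exists_int_isXPresentation_gamma1 D₁ hc
  obtain ⟨a, hgrowth⟩ := exists_exponent_isZeroAtImInfty D₁.f hf (D₁.L.mulLeft ((D₁.c : ℂ)⁻¹) (inv_ne_zero hc))
    (Gamma1 N)
  obtain ⟨A, hAhol, hAeq, hAstab⟩ := CDivision.exists_cDivisionWitness_of_presentation D₁.f hf (lattice_L₁_le_L'' D₁ hc)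
    (by omega : (0 : ℤ) ≤ k) hX a
  have hinv : ∀ γ ∈ Gamma1 N, A ∣[k + 12 * (a : ℤ)] γ = A := fun γ hγ ↦
    (hAstab ⟨γ, Gamma1_in_Gamma0 N hγ⟩).mp (cuspSymbol_mem_L₁ D₁ hc ⟨γ, Gamma1_in_Gamma0 N hγ⟩ hγ)
  have hAeq' : ∀ τ : ℍ, eichlerIntegral D₁.f τ ∉ (D₁.L.mulLeft ((D₁.c : ℂ)⁻¹) (inv_ne_zero hc)).lattice →
      A τ = ℘[D₁.L.mulLeft ((D₁.c : ℂ)⁻¹) (inv_ne_zero hc)] (eichlerIntegral D₁.f τ) *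
        ((12 : ℂ) * (G : ModularForm (Gamma0 N) k) τ * ModularForm.discriminant τ ^ a) := by
    intro τ hτ
    rw [← hAeq τ hτ]
    change _ = _ * ((12 : ℂ) * G τ * _)
    ring
  have hzero : ∀ g : SL(2, ℤ), IsZeroAtImInfty (A ∣[k + 12 * (a : ℤ)] g) :=
    hgrowth k (G : ModularForm (Gamma0 N) k) A hinv hAeq'
  refine ⟨k, a, G, A, hk, hX.1, hGint, ?_, hzero, hAeq⟩
  rw [mem_formSpace_iff]
  refine ⟨hAhol, ?_, fun g ↦ ?_⟩
  · rintro _ ⟨γ, hγ, rfl⟩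
    change A ∣[k + 12 * (a : ℤ)] γ = A
    exact hinv γ hγ
  · rw [← ModularForm.SL_slash]
    exact (hzero g).isBoundedAtImInfty

/-! ## §3 The same with the exponent `a ≥ 2` exported (APPEND, p1 gen 22) -/

/-- **Datum-free growth lemma, with `2 ≤ a`.**  Same statement as `exists_exponent_isZeroAtImInfty`, recording that the exponent
constructed there is at least `2` (needed to divide `Δ^a` by `𝕢²`). [cite: ShimuraIATAF1971, §2.4, Thm. 7.14] -/
theorem exists_exponent_isZeroAtImInfty_two_le (f : CuspForm (Gamma0 N) 2) (hf : f ≠ 0) (L : PeriodPair)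
    (Γ : Subgroup SL(2, ℤ)) [Γ.FiniteIndex] :
    ∃ a : ℕ, 2 ≤ a ∧ ∀ (w : ℤ) (B : ModularForm (Gamma0 N) w) (F : ℍ → ℂ), (∀ γ ∈ Γ, F ∣[w + 12 * (a : ℤ)] γ = F) →
      (∀ τ : ℍ, eichlerIntegral f τ ∉ L.lattice →
        F τ = ℘[L] (eichlerIntegral f τ) * ((12 : ℂ) * B τ * ModularForm.discriminant τ ^ a)) →
      ∀ g : SL(2, ℤ), IsZeroAtImInfty (F ∣[w + 12 * (a : ℤ)] g) := by
  classical
  obtain ⟨R, hR⟩ := exists_finset_mul_cover Γ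
  set m : SL(2, ℤ) → ℕ := fun r ↦ analyticOrderNatAt (cuspFunction N (verticalIntegral (⇑f ∣[(2 : ℤ)] r))) 0 with hm
  set a : ℕ := 2 + ∑ r ∈ R, (2 * m r + 1) with ha
  have haR : ∀ r ∈ R, 2 * m r + 1 ≤ a := fun r hr ↦
    (Finset.single_le_sum (f := fun r ↦ 2 * m r + 1) (fun _ _ ↦ Nat.zero_le _) hr).trans (Nat.le_add_left _ _)
  refine ⟨a, Nat.le_add_right _ _, fun w B F hFinv hFeq g ↦ ?_⟩
  obtain ⟨γ, hγ, r, hr, hg⟩ := hR g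
  have hslash : F ∣[w + 12 * (a : ℤ)] g = F ∣[w + 12 * (a : ℤ)] r := by
    rw [hg, SlashAction.slash_mul, hFinv γ hγ]
  obtain ⟨C, hC⟩ := exists_eichlerIntegral_smul_eq f r
  obtain ⟨T, hT⟩ := exists_forall_eichlerIntegral_smul_notMem f hf L r
  have hlim := (isCuspFunction_verticalIntegral_slash f r).tendsto_weierstrassP_mul_pow_atImInfty
    (verticalIntegral_slash_ne_zero f hf r) isCuspFunction_discriminant L C (haR r hr)
  have hbdd : IsBoundedUnder (· ≤ ·) atImInfty (fun τ : ℍ ↦ ‖(12 : ℂ) * (⇑B ∣[w] r) τ‖) := by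
    obtain ⟨M, A, hM⟩ := UpperHalfPlane.isBoundedAtImInfty_iff.mp (ModularFormClass.bdd_at_infty_slash B r)
    refine ⟨12 * M, ?_⟩
    rw [Filter.eventually_map]
    filter_upwards [(atImInfty_mem _).mpr ⟨A, fun _ h ↦ h⟩] with τ hτ
    rw [norm_mul, Complex.norm_ofNat]
    exact mul_le_mul_of_nonneg_left (hM τ hτ) (by norm_num)
  have hprod := hlim.zero_mul_isBoundedUnder_le hbdd
  rw [hslash]
  refine (hprod.congr' ?_ : Tendsto (F ∣[w + 12 * (a : ℤ)] r) atImInfty (𝓝 0))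
  filter_upwards [(atImInfty_mem _).mpr ⟨T, fun _ h ↦ h⟩] with τ hτ
  have hd : denom (r : SL(2, ℤ)) τ ≠ 0 := denom_ne_zero _ τ
  have hval : (F ∣[w + 12 * (a : ℤ)] r) τ =
      ℘[L] (C + verticalIntegral (⇑f ∣[(2 : ℤ)] r) τ) * ModularForm.discriminant τ ^ a *
        ((12 : ℂ) * (⇑B ∣[w] r) τ) := by
    rw [ModularForm.SL_slash_apply, ModularForm.SL_slash_apply, hFeq (r • τ) (hT τ hτ), hC τ, discriminant_apply_smul r τ,
      mul_pow, ← zpow_natCast, ← zpow_mul, neg_add, zpow_add₀ hd, zpow_neg, zpow_neg]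
    field_simp
  exact hval.symm

/-- **The `x`-presentation on `Γ₁(N)` with `a ≥ 2`** (same as `exists_xPresentation`, exporting `2 ≤ a`).
[cite: ShimuraIATAF1971, §2.4 and Thm. 7.14] [cite: Stevens1982, §1.3] -/
theorem exists_xPresentation_two_le {W : WeierstrassCurve ℚ} (D₁ : Gamma1ParametrizationData W N) (hc : (D₁.c : ℂ) ≠ 0) :
    ∃ (k : ℤ) (a : ℕ) (G : CuspForm (Gamma0 N) k) (A : ℍ → ℂ), 12 ≤ k ∧ 2 ≤ a ∧ G ≠ 0 ∧ (∀ m, ∃ z : ℤ, cuspCoeff G m = z) ∧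
      A ∈ formSpace (Gamma1 N : Subgroup SL(2, ℤ)) (k + 12 * (a : ℤ)) ∧
      (∀ g : SL(2, ℤ), IsZeroAtImInfty (A ∣[k + 12 * (a : ℤ)] g)) ∧
      ∀ τ : ℍ, eichlerIntegral D₁.f τ ∉ (D₁.L.mulLeft ((D₁.c : ℂ)⁻¹) (inv_ne_zero hc)).lattice →
        12 * ℘[D₁.L.mulLeft ((D₁.c : ℂ)⁻¹) (inv_ne_zero hc)] (eichlerIntegral D₁.f τ) * G τ * ModularForm.discriminant τ ^ a = A τ := by
  have hf : D₁.f ≠ 0 := D₁.isNewformOf.1.ne_zero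
  obtain ⟨k, Fx, G, hk, hX, hGint⟩ := CDivision.exists_int_isXPresentation_gamma1 D₁ hc
  obtain ⟨a, ha2, hgrowth⟩ := exists_exponent_isZeroAtImInfty_two_le D₁.f hf (D₁.L.mulLeft ((D₁.c : ℂ)⁻¹) (inv_ne_zero hc))
    (Gamma1 N)
  obtain ⟨A, hAhol, hAeq, hAstab⟩ := CDivision.exists_cDivisionWitness_of_presentation D₁.f hf (lattice_L₁_le_L'' D₁ hc)
    (by omega : (0 : ℤ) ≤ k) hX a
  have hinv : ∀ γ ∈ Gamma1 N, A ∣[k + 12 * (a : ℤ)] γ = A := fun γ hγ ↦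
    (hAstab ⟨γ, Gamma1_in_Gamma0 N hγ⟩).mp (cuspSymbol_mem_L₁ D₁ hc ⟨γ, Gamma1_in_Gamma0 N hγ⟩ hγ)
  have hAeq' : ∀ τ : ℍ, eichlerIntegral D₁.f τ ∉ (D₁.L.mulLeft ((D₁.c : ℂ)⁻¹) (inv_ne_zero hc)).lattice →
      A τ = ℘[D₁.L.mulLeft ((D₁.c : ℂ)⁻¹) (inv_ne_zero hc)] (eichlerIntegral D₁.f τ) *
        ((12 : ℂ) * (G : ModularForm (Gamma0 N) k) τ * ModularForm.discriminant τ ^ a) := by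
    intro τ hτ
    rw [← hAeq τ hτ]
    change _ = _ * ((12 : ℂ) * G τ * _)
    ring
  have hzero : ∀ g : SL(2, ℤ), IsZeroAtImInfty (A ∣[k + 12 * (a : ℤ)] g) :=
    hgrowth k (G : ModularForm (Gamma0 N) k) A hinv hAeq'
  refine ⟨k, a, G, A, hk, ha2, hX.1, hGint, ?_, hzero, hAeq⟩
  rw [mem_formSpace_iff]
  refine ⟨hAhol, ?_, fun g ↦ ?_⟩
  · rintro _ ⟨γ, hγ, rfl⟩
    change A ∣[k + 12 * (a : ℤ)] γ = A
    exact hinv γ hγ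
  · rw [← ModularForm.SL_slash]
    exact (hzero g).isBoundedAtImInfty

end Summit.BirchSwinnertonDyer.BirchSwinnertonDyer.Theorems.ManinLocalTwoThree.StevensGalois

end
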